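/-
Copyright (c) 2026. All rights reserved.
Released under Apache 2.0 license as described in the file LICENSE.
Authors: abc-iut cell, seat abc-iut-L4-t14 (gen 3; proof-only: hypothesis (Z) of the group model
`Loc(N, Γ)` is not idle — central elements give non-trivial automorphisms of the identity).
-/
import Literature.AnabelianGeometry.AbsoluteAnabelian.LocCategoryGroupModel
import Mathlib.Data.ZMod.QuotientGroup
import HarnessLib

/-!
# `Loc(N, Γ)` is NOT id-rigid in the presence of centre ([AbsTopIII] Prop 4.2 (i) / Rmk 4.2.1 shape)

S. Mochizuki, *Topics in absolute anabelian geometry III*, proof of Prop 4.2 (i) p. 106 l. 14–19 and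
Rmk 4.2.1 p. 106 l. 27–30 (kurims manuscript `paper:url-5493eb38cbb7`; bib key
`MochizukiAbsTopIII2015`): the id-rigidity of `Loc_R(X)` rests on SLIMNESS (Lemma 4.3); "the
id-rigidity … is [as is easily verified] false" for the variants with more symmetry.

PROOF-ONLY companion (no new notion) of abc-iut-L4-t14's `LocCategoryGroupModel.lean` (p432943:
`Loc(N, Γ)` id-rigid ⇐ hypothesis (Z)), recording that (Z) is NOT an idle hypothesis — the exact
analogue, for the not-over-`X` category `Loc(N, Γ)`, of the tree's `not_isIdRigid_bCat_of_mem_center`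
(abc-iut-w6-d025, `B(Π)` with `Z(Π) ≠ 1`):

* `LocObj.exists_idIso_app_eq_homMk` — a CENTRAL element `z ∈ Z(N)` defines an automorphism of
  `𝟭_{Loc(N,Γ)}` with components `[z] : Λ → Λ` (natural along every `[g]` because `z g z⁻¹ g⁻¹ = 1`);
* `LocObj.not_isIdRigid_of_mem_center` — if moreover `z ∉ Λ` for some finite-index `Λ ≤ Γ`, then
  `Loc(N, Γ)` is NOT id-rigid (so (Z) fails there: `centralFamiliesTrivial` is refuted too,
  `LocObj.not_centralFamiliesTrivial_of_mem_center`);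
* `LocObj.not_isIdRigid_int` — instance: `N = Γ = ℤ` (written multiplicatively), `z = 1`, `Λ = 2ℤ`:
  the category of finite-index subgroups of `ℤ` with translation-inclusions is not id-rigid
  (its `Aut(𝟭)` is `Ẑ`).

Refereed pre-IUT material; nothing here bears on [IUTchIII] Cor. 3.12 or takes a side; model ≠
reconstruction.
-/

set_option autoImplicit false

namespace Literature.AnabelianGeometry.AbsoluteAnabelian

namespace LocObj

open _root_.CategoryTheory

universe u

variable {N : Type u} [Group N] {Γ : Subgroup N}

/-- A central element of `N` lying in `Γ` represents an endomorphism `[z] : Λ → Λ` of every object.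
[cite: MochizukiAbsTopIII2015, Proposition 4.2 (i) proof p.106] -/
theorem conj_mem_of_mem_center {z : N} (hz : z ∈ Subgroup.center N) (Λ : LocObj Γ) :
    ∀ x ∈ Λ.toSubgroup, z * x * z⁻¹ ∈ Λ.toSubgroup := by
  intro x hx
  have : z * x * z⁻¹ = x := by
    rw [Subgroup.mem_center_iff] at hz
    rw [← hz x, mul_inv_cancel_right]
  rw [this]
  exact hx

/-- **The automorphism of `𝟭_{Loc(N,Γ)}` defined by a central `z`**: components `[z]`, inverse
components `[z⁻¹]`; naturality along `[g] : Λ₁ → Λ₂` is `g z (z g)⁻¹ = 1 ∈ Λ₂`.  Stated as an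
existence (proof-only file). [cite: MochizukiAbsTopIII2015, Remark 4.2.1 p.106] -/
theorem exists_idIso_app_eq_homMk {z : N} (hz : z ∈ Subgroup.center N) :
    ∃ α : 𝟭 (LocObj Γ) ≅ 𝟭 (LocObj Γ), ∀ Λ, α.hom.app Λ = homMk z (conj_mem_of_mem_center hz Λ) := by
  have hz' : z⁻¹ ∈ Subgroup.center N := Subgroup.inv_mem _ hz
  refine ⟨{ hom := { app := fun Λ => homMk z (conj_mem_of_mem_center hz Λ), naturality := ?_ },
            inv := { app := fun Λ => homMk z⁻¹ (conj_mem_of_mem_center hz' Λ), naturality := ?_ },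
            hom_inv_id := ?_,
            inv_hom_id := ?_ }, fun Λ => rfl⟩
  · intro Λ₁ Λ₂ f
    obtain ⟨g, hg, rfl⟩ := exists_eq_homMk f
    simp only [Functor.id_obj, Functor.id_map, homMk_comp_homMk]
    rw [homMk_eq_homMk_iff]
    have : g * z * (z * g)⁻¹ = 1 := by
      rw [Subgroup.mem_center_iff] at hz
      rw [hz g, mul_inv_cancel]
    rw [this]
    exact Λ₂.toSubgroup.one_mem
  · intro Λ₁ Λ₂ f
    obtain ⟨g, hg, rfl⟩ := exists_eq_homMk f
    simp only [Functor.id_obj, Functor.id_map, homMk_comp_homMk]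
    rw [homMk_eq_homMk_iff]
    have : g * z⁻¹ * (z⁻¹ * g)⁻¹ = 1 := by
      rw [Subgroup.mem_center_iff] at hz'
      rw [hz' g, mul_inv_cancel]
    rw [this]
    exact Λ₂.toSubgroup.one_mem
  · ext Λ
    simp only [NatTrans.comp_app, Functor.id_obj, NatTrans.id_app, homMk_comp_homMk, id_eq_homMk]
    rw [homMk_eq_homMk_iff]
    simp [Λ.toSubgroup.one_mem]
  · ext Λ
    simp only [NatTrans.comp_app, Functor.id_obj, NatTrans.id_app, homMk_comp_homMk, id_eq_homMk]
    rw [homMk_eq_homMk_iff]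
    simp [Λ.toSubgroup.one_mem]

/-- **(Z) is not idle: a central `z ∈ N` outside some finite-index `Λ ≤ Γ` makes `Loc(N, Γ)`
NOT id-rigid** (the `[z]` are a non-identity automorphism of `𝟭`).  Analogue for `Loc` of the tree's
`not_isIdRigid_bCat_of_mem_center`. [cite: MochizukiAbsTopIII2015, Remark 4.2.1 p.106] -/
theorem not_isIdRigid_of_mem_center {z : N} (hz : z ∈ Subgroup.center N) (Λ : LocObj Γ)
    (hzΛ : z ∉ Λ.toSubgroup) : ¬ IsIdRigid (LocObj Γ) := by
  intro h
  obtain ⟨α, hα⟩ := exists_idIso_app_eq_homMk (Γ := Γ) hz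
  have happ := congrArg (fun β : 𝟭 (LocObj Γ) ≅ 𝟭 (LocObj Γ) => β.hom.app Λ) (h α)
  simp only [hα, Iso.refl_hom, NatTrans.id_app, Functor.id_obj, id_eq_homMk] at happ
  rw [homMk_eq_homMk_iff] at happ
  -- happ : 1 * z⁻¹ ∈ Λ
  apply hzΛ
  have := Λ.toSubgroup.inv_mem happ
  simpa using this

/-- Consequently hypothesis (Z) itself FAILS there (contrapositive of
`isIdRigid_of_centralFamiliesTrivial`). [cite: MochizukiAbsTopIII2015, Remark 4.2.1 p.106] -/
theorem not_centralFamiliesTrivial_of_mem_center {z : N} (hz : z ∈ Subgroup.center N)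
    (Λ : LocObj Γ) (hzΛ : z ∉ Λ.toSubgroup) : ¬ CentralFamiliesTrivial Γ :=
  fun hZ => not_isIdRigid_of_mem_center hz Λ hzΛ (isIdRigid_of_centralFamiliesTrivial hZ)

/-! ### Instance: `N = Γ = ℤ` -/

/-- **`Loc(ℤ, ℤ)` is not id-rigid** (`z = 1 ∈ Z(ℤ) = ℤ`, `1 ∉ 2ℤ`): the category of finite-index
subgroups of `ℤ` with the translation-inclusions is not id-rigid — centre is the obstruction, exactly as
for `B(Ẑ)`. [cite: MochizukiAbsTopIII2015, Remark 4.2.1 p.106] -/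
theorem not_isIdRigid_int : ¬ IsIdRigid (LocObj (⊤ : Subgroup (Multiplicative ℤ))) := by
  haveI : (AddSubgroup.toSubgroup (AddSubgroup.zmultiples (2 : ℤ))).FiniteIndex :=
    ⟨by rw [AddSubgroup.index_toSubgroup, Int.index_zmultiples]; decide⟩
  -- the object `2ℤ ≤ ℤ` (index 2), multiplicative notation
  refine not_isIdRigid_of_mem_center (z := Multiplicative.ofAdd (1 : ℤ))
    (Subgroup.mem_center_iff.mpr fun g => mul_comm g _)
    { toSubgroup := AddSubgroup.toSubgroup (AddSubgroup.zmultiples (2 : ℤ))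
      le := le_top
      finiteIndex := inferInstance } ?_
  intro h
  change Multiplicative.ofAdd (1 : ℤ) ∈ AddSubgroup.toSubgroup (AddSubgroup.zmultiples (2 : ℤ)) at h
  rw [Multiplicative.mem_toSubgroup, toAdd_ofAdd, Int.mem_zmultiples_iff] at h
  omega

end LocObj

end Literature.AnabelianGeometry.AbsoluteAnabelian
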